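import Summits.BirchSwinnertonDyer.BirchSwinnertonDyer.Theorems.ThetaPartnerAtTwoSignedControlAtTwoShaTwoPrimaryVanishing
import Summits.BirchSwinnertonDyer.BirchSwinnertonDyer.Theorems.ThetaPartnerAtTwoSignedControlAtTwoNoFiniteSubmoduleOfShaTwo
import Literature.NumberTheory.GaloisRepresentations.NumberFieldCdTwoProofs
import Literature.NumberTheory.GaloisRepresentations.ContinuousH2OrderTwo
import Literature.NumberTheory.EllipticCurves.IwasawaTowerTorsionProofs
import HarnessLib

/-!
# `Ш²(K, E[p^∞]) = 0` for EVERY number field `K` and every ODD prime `p`, modulo Poitou–Tate (a) ALONE —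
# hence DIV «`(γ−1)·H¹(K_∞, E[p^∞]) = H¹(K_∞, E[p^∞])`» and «no finite `Λ`-submodule» at odd `p`
# (crux K4 `SignedControlAtTwo` inputs, stmt-BirchSwinnertonDyer-20309; Greenberg Prop. 4.12 elimination at odd `p`)

Seat `bsd-inputs-k4-p1` (ASIDE seat of the K4 Greenberg-1999 inputs; no claim).  THEOREMS ONLY (no definition, no
named fact, no `sorry`); `poitouTate_sha_tateDual K` (Milne I 4.10 (a)) enters as a HYPOTHESIS BY NAME.

Width seat w2's halving argument (`SignedEC.ShaTwo.exists_nsmul_eq_of_mem_shaTwo`, Milne I Lemma 6.12 / Thm. 6.13 (c)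
run inside `Ш²`) needs two archimedean Poitou–Tate rows: `H³(K, E[p]) ↪ ⊕_{w real} H³(K_w, E[p])` (4.10 (c)₃) to lift
along `0 → E[p] → E[p^{M+1}] →ᵖ E[p^M] → 0`, and `H²(K, E[p]) ↠ ⊕_{w real} H²(K_w, E[p])` (Cor. 4.16) to correct the
lift at the real places.  AT AN ODD PRIME BOTH ARE FREE:

* `H³(K, E[p]) = 0` outright — `cd_p(Γ_K) ≤ 2` for `p ≠ 2` is the tree THEOREM
  `fieldCdLE_two_of_numberField_holds` (Serre, *Cohomologie galoisienne* II §4.4 Prop. 13;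
  `Literature/…/NumberFieldCdTwoProofs.lean`) — `subsingleton_galoisCohomology_three_torsion_of_ne_two`;
* `H²(K_w, E[p^{M+1}]) = 0` at every infinite `w` — `#Γ_{K_w} ≤ 2` kills `H²` by `2`, the module is killed by the
  odd `p^{M+1}` (`galoisCohomology_two_toLocal_inl_eq_zero_of_odd`, `Literature/…/ContinuousH2OrderTwo.lean`).

So (`exists_nsmul_eq_of_mem_shaTwo_of_ne_two`) every `c ∈ Ш²(K, E[p^∞])` is `p · c'`, `c' ∈ Ш²`, for EVERY number
field `K` (no totally-real hypothesis) and odd `p`, with NO archimedean input and the finite-place vanishing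
`H²(K_v, E[p^∞]) = 0` from this seat's `subsingleton_galoisCohomology_two_toLocal_primaryTorsion`; with w2's
finiteness (`finite_shaTwo_primary_and_natCard_le` ⟸ `poitouTate_sha_tateDual K` + `Sel_{p^∞}(E/K)` finite +
`E[p^∞]^{Γ_K} = 0`) and `p`-primarity: **`Ш²(K, E[p^∞]) = 0` modulo PT(a) alone**
(`forall_mem_shaTwo_primary_eq_zero_of_ne_two`, `shaTwo_primary_eq_bot_of_ne_two`).  Then this seat's
`…DivOfShaTwoAnyField` / `…NoFiniteSubmoduleOfShaTwo` give, for every `ℤ_p`-extension `κ` and topological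
generator `γ`: DIV (`forall_exists_conjH1_sub_eq_of_ne_two`) and «no nonzero finite `Λ`-submodule in the
Pontryagin dual of `H¹(K_∞, E[p^∞])`» (`dual_forall_finite_eq_bot_of_ne_two`) — Greenberg's Prop. 4.9 / 4.12
conclusion for the full group, at odd `p`, from ONE generic class-field-theory statement.  Consumers: the odd-`p`
ports of the COUNT door (row 8, `SignedLowerHalves.SharpFlatCharValueRankZeroAllLevels`: `sharpFlatCount_of_print`
displays {Cassels, Prop. 4.12, Kato 12.4}); X11b / JSW-type arguments at odd `p`.
BSD is not proved by any of this; no summit statement is proved by this seat; closes no item by itself.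

References: [MilneADT2006] I Thm. 4.10 (a), Lemma 6.12, Thm. 6.13 (c), Rem. 3.7; [SerreGaloisCohomology1997] I §2.4,
II §4.4 Prop. 13; [GreenbergLNM1716] §4 Appendix Prop. 4.9, 4.10, 4.12 (pp. 113–119); [Washington1997] §13.2.
-/

set_option autoImplicit false
-- the Theorems namespace of this sub repeats the summit name by design (D-0017 nested layout)
set_option linter.dupNamespace false

noncomputable section

open scoped Classical NumberField

namespace Summit.BirchSwinnertonDyer.BirchSwinnertonDyer.Theorems.SignedEC.PrimaryTorsionH2

open Function NumberField IsDedekindDomain Field WeierstrassCurve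
open _root_.TopRep _root_.ContinuousCohomology
open Literature.NumberTheory.EllipticCurves Literature.NumberTheory.GaloisRepresentations
  Literature.NumberTheory.GaloisCohomology Literature.NumberTheory.EllipticCurves.IwasawaAlgebra
open Literature.NumberTheory.GaloisRepresentations.DiscreteGaloisModule (shaTwo mem_shaTwo_iff)
open Summit.BirchSwinnertonDyer.Rank1Residual.X11b
open Summit.BirchSwinnertonDyer.Rank1Residual.X11b.Levels (primaryInclusion)

variable {K : Type} [Field K] [NumberField K] (W : WeierstrassCurve K) [W.IsElliptic]
  (p : ℕ) [hp : Fact p.Prime]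

omit [W.IsElliptic] in
/-- **`H³(K, E[p]) = 0` for a number field `K` and an odd prime `p`**: `cd_p(Γ_K) ≤ 2` (Serre II §4.4 Prop. 13,
tree theorem `fieldCdLE_two_of_numberField_holds`) and `E[p]` is `p`-primary.
[cite: SerreGaloisCohomology1997, II §4.4 Prop. 13] -/
theorem subsingleton_galoisCohomology_three_torsion_of_ne_two (hp2 : p ≠ 2) :
    Subsingleton (galoisCohomology (W.torsionGaloisModule ((p : ℕ) : ℤ)) 3) := by
  have hcd : GroupCdLE (absoluteGaloisGroup K) p 2 :=
    fieldCdLE_two_of_ne_two fieldCdLE_two_of_numberField_holds K p hp2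
  have hprim : IsPrimaryTorsion p (W.geomTorsion ((p : ℕ) : ℤ)) := fun P ↦ by
    have hP : ((p : ℕ) : ℤ) • (P : W.geomPoints) = 0 := (W.mem_geomTorsion_iff _ _).mp P.2
    refine ⟨1, Subtype.ext ?_⟩
    rw [AddSubgroupClass.coe_nsmul, pow_one, ← natCast_zsmul, hP]
    rfl
  exact hcd _ (W.torsionGaloisModule ((p : ℕ) : ℤ)) hprim (by norm_num)

/-- **Halving in `Ш²(K, E[p^∞])` at an odd prime, every number field** (Milne I Lemma 6.12 / Thm. 6.13 (c) inside
`Ш²`, with both archimedean rows free): `c = ι_M z`, `z ∈ Ш²(K, E[p^M])` (w2's part 4a); `z = p_* y` along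
`0 → E[p] → E[p^{M+1}] →ᵖ E[p^M] → 0` since `H³(K, E[p]) = 0` (`cd_p ≤ 2`, `p` odd); `c' = ι_{M+1} y` lies in `Ш²`
(finite places: `H²(K_v, E[p^∞]) = 0`; infinite places: `H²(K_w, E[p^{M+1}]) = 0`, odd level) and `p · c' = c`.
[cite: MilneADT2006, Ch. I, Lemma 6.12, Thm. 6.13 (c), Rem. 3.7] [cite: SerreGaloisCohomology1997, II §4.4 Prop. 13] -/
theorem exists_nsmul_eq_of_mem_shaTwo_of_ne_two (hp2 : p ≠ 2)
    (c : galoisCohomology (LocBridge.primaryGaloisModule W p) 2)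
    (hc : c ∈ shaTwo (LocBridge.primaryGaloisModule W p)) :
    ∃ c' ∈ shaTwo (LocBridge.primaryGaloisModule W p), p • c' = c := by
  haveI : NeZero p := ⟨hp.out.ne_zero⟩
  haveI : Finite (W.geomTorsion ((p : ℕ) : ℤ)) := finite_geomTorsion_of_neZero W p
  haveI : CompactSpace (absoluteGaloisGroup K) := absoluteGaloisGroup_compactSpace K
  obtain ⟨M, -, z, hz, rfl⟩ := ShaTwo.exists_mem_shaTwo_map_primaryInclusion_eq W p c hc
  have hses := ShaTwo.isSES_torsionInclusion_levelMul W p M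
  haveI := subsingleton_galoisCohomology_three_torsion_of_ne_two W p hp2
  obtain ⟨y, hy⟩ := ShaTwo.IsSES.exists_map_two_eq_of_forall_localization_inl hses
    (fun c _ ↦ Subsingleton.elim _ _) z (fun w ↦ (mem_shaTwo_iff _ _).1 hz (Sum.inl w))
  rw [DiscreteGaloisModule.cohomologyMap_homOfIntertwining] at hy
  -- the level `p^{M+1}` is odd
  have hodd : Odd (p ^ (M + 1)) := (hp.out.odd_of_ne_two hp2).pow
  have hkill : ∀ m : W.geomTorsion ((p ^ (M + 1) : ℕ) : ℤ), p ^ (M + 1) • m = 0 := fun m ↦ by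
    have hm : ((p ^ (M + 1) : ℕ) : ℤ) • (m : W.geomPoints) = 0 := (W.mem_geomTorsion_iff _ _).mp m.2
    apply Subtype.ext
    rw [AddSubgroupClass.coe_nsmul, ← natCast_zsmul, hm]
    rfl
  refine ⟨galoisCohomology.map (primaryInclusion W p (M + 1)) 2 y, (mem_shaTwo_iff _ _).2 ?_, ?_⟩
  · rintro (w | v)
    · -- infinite place: `H²(K_w, E[p^{M+1}]) = 0` at odd level
      rw [ShaTwo.localization_inl_map_two,
        galoisCohomology_two_toLocal_inl_eq_zero_of_odd (W.torsionGaloisModule ((p ^ (M + 1) : ℕ) : ℤ)) w hodd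
          hkill (galoisCohomology.localization (W.torsionGaloisModule ((p ^ (M + 1) : ℕ) : ℤ)) (Sum.inl w) 2 y)]
      exact map_zero _
    · -- finite place: `H²(K_v, E[p^∞]) = 0`
      haveI := subsingleton_galoisCohomology_two_toLocal_primaryTorsion W p v
        (LocBridge.primaryGaloisModule W p) (fun _ _ ↦ rfl)
      exact Subsingleton.elim _ _
  · rw [← hy, ShaTwo.map_two_map_two_eq_nsmul_map_two (Levels.levelMul W p M 1) (primaryInclusion W p M)
      (primaryInclusion W p (M + 1)) (p ^ 1) (Levels.primaryInclusion_levelMul W p M 1), pow_one]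

/-- **`Ш²(K, E[p^∞]) = 0` for every number field `K` and odd prime `p`, modulo Poitou–Tate (a) alone**: given
`poitouTate_sha_tateDual K` (FINITE, w2's `finite_shaTwo_primary_and_natCard_le`), `Sel_{p^∞}(E/K)` finite and
`E[p^∞]^{Γ_K} = 0`, the finite `p`-primary `p`-divisible group `Ш²` vanishes.
[cite: MilneADT2006, Ch. I, Thm. 4.10 (a), Thm. 6.13 (c)] [cite: SerreGaloisCohomology1997, II §4.4 Prop. 13] -/
theorem forall_mem_shaTwo_primary_eq_zero_of_ne_two (hp2 : p ≠ 2) (hPT : poitouTate_sha_tateDual K)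
    [Finite (W.selmerGroupPInfty p)]
    (hΓ : ∀ Q : W.geomPrimaryTorsion p,
      (∀ σ : absoluteGaloisGroup K, LocBridge.primaryGaloisModule W p σ Q = Q) → Q = 0) :
    ∀ c ∈ shaTwo (LocBridge.primaryGaloisModule W p), c = 0 := by
  haveI := (ShaTwo.finite_shaTwo_primary_and_natCard_le W p hPT hΓ).1
  exact ShaTwo.eq_zero_of_finite_of_primary_of_divisible p (shaTwo (LocBridge.primaryGaloisModule W p))
    (fun c _ ↦ Summit.BirchSwinnertonDyer.Rank1Residual.X11b.WeakLeopoldt.exists_pow_smul_eq_zero W p c)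
    (fun c hc ↦ exists_nsmul_eq_of_mem_shaTwo_of_ne_two W p hp2 c hc)

/-- **`Ш²(K, E[p^∞]) = ⊥`, `p` odd, any number field, `Sel_{p^∞}(E/K)` finite, `E(K)[p] = 0`** (the latter as
`hK : ∀ P, p • P = 0 → P = 0`, giving `E[p^∞]^{Γ_K} = 0` by `WeierstrassCurve.eq_zero_of_forall_smul_eq`), modulo
`poitouTate_sha_tateDual K` alone. [cite: MilneADT2006, Ch. I, Thm. 4.10 (a), Thm. 6.13 (c)] -/
theorem shaTwo_primary_eq_bot_of_ne_two (hp2 : p ≠ 2) (hPT : poitouTate_sha_tateDual K)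
    [Finite (W.selmerGroupPInfty p)] (hK : ∀ P : W.toAffine.Point, p • P = 0 → P = 0) :
    shaTwo (LocBridge.primaryGaloisModule W p) = ⊥ := by
  rw [eq_bot_iff]
  intro c hc
  rw [AddSubgroup.mem_bot]
  exact forall_mem_shaTwo_primary_eq_zero_of_ne_two W p hp2 hPT
    (fun Q hQ ↦ W.eq_zero_of_forall_smul_eq (p := p) hK fun σ ↦ hQ σ) c hc

variable (κ : ZpExtension K p) {γ : absoluteGaloisGroup K}

/-- **DIV at an odd prime, every number field, modulo Poitou–Tate (a) alone**: for every `ℤ_p`-extension `κ`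
of `K` (`p ≠ 2`), topological generator `γ`, and elliptic `W/K` with `Sel_{p^∞}(E/K)` finite and `E(K)[p] = 0`,
every class `s ∈ H¹(Gal(K̄/K_∞), E[p^∞])` is `conj_γ t − t` — the «(γ−1)-divisibility» that Greenberg's Prop. 4.12
supplies to the control arguments, with NO Greenberg-1999 / Kato input and no archimedean row.
[cite: GreenbergLNM1716, §4 Appendix Prop. 4.10, Prop. 4.12 (pp. 116–119)] [cite: MilneADT2006, Ch. I, Thm. 4.10 (a)] -/
theorem forall_exists_conjH1_sub_eq_of_ne_two (hp2 : p ≠ 2) (hγ : κ.IsTopGenerator γ)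
    (hPT : poitouTate_sha_tateDual K) [Finite (W.selmerGroupPInfty p)]
    (hK : ∀ P : W.toAffine.Point, p • P = 0 → P = 0) (s : W.subgroupH1 p κ.kerSubgroup) :
    ∃ t : W.subgroupH1 p κ.kerSubgroup, W.conjH1 p κ.kerSubgroup γ t - t = s :=
  forall_exists_conjH1_sub_eq_of_shaTwo_eq_bot W p κ hγ (shaTwo_primary_eq_bot_of_ne_two W p hp2 hPT hK) s

/-- **No nonzero finite `Λ`-submodule in the Pontryagin dual of `H¹(K_∞, E[p^∞])` at an odd prime, every number
field, modulo Poitou–Tate (a) alone** (Greenberg's Prop. 4.9 / 4.12 conclusion for the full group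
`H¹(Gal(K̄/K_∞), E[p^∞])`): for every `Λ`-module `Y` mapped injectively into `Hom(H¹(K_∞, E[p^∞]), ℚ/ℤ)` with `T`
acting as `conj_γ − 1`. [cite: GreenbergLNM1716, §4 Appendix Prop. 4.9 (p. 113), Prop. 4.12 (p. 119)]
[cite: Washington1997, §13.2] -/
theorem dual_forall_finite_eq_bot_of_ne_two (hp2 : p ≠ 2) (hγ : κ.IsTopGenerator γ)
    (hPT : poitouTate_sha_tateDual K) [Finite (W.selmerGroupPInfty p)]
    (hK : ∀ P : W.toAffine.Point, p • P = 0 → P = 0)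
    {Y : Type*} [AddCommGroup Y] [Module (IwasawaAlgebra p) Y]
    (dY : Y →+ (W.subgroupH1 p κ.kerSubgroup →+ AddCircle (1 : ℚ))) (hinj : Function.Injective dY)
    (hT : ∀ (y : Y) (x : W.subgroupH1 p κ.kerSubgroup),
      dY ((PowerSeries.X : IwasawaAlgebra p) • y) x = dY y (W.conjH1 p κ.kerSubgroup γ x) - dY y x) :
    ∀ N : Submodule (IwasawaAlgebra p) Y, Finite N → N = ⊥ :=
  dual_forall_finite_eq_bot_of_shaTwo_eq_bot W p κ hγ (shaTwo_primary_eq_bot_of_ne_two W p hp2 hPT hK)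
    dY hinj hT

end Summit.BirchSwinnertonDyer.BirchSwinnertonDyer.Theorems.SignedEC.PrimaryTorsionH2

end
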